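import Summits.CriticalPhenomena.PercolationContinuityZ3.Theorems.PercAnnulusCrossingSharpThresholdEffective
import HarnessLib

/-!
# RSW3 lane (lead, gen 18): PIVOTAL EDGES AT CRITICALITY — the dichotomy at `p_c(ℤ³)` ('nearly decided or many pivotals'), and
# `CubeCrossingNondegenerate` (BCKS) ⇒ the expected number of pivotal edges of the cube crossing AT `p_c` diverges like `|log 2π_{p_c}(n/2)|`

builds on p205010 (kernel theorem, internal audit signed; external expert review pending) — USED only to make
`π_{p_c}(⌊(n−3)/2⌋) → 0` (`θ(p_c) = 0`), i.e. `Λ_n := log(1/(2π_{p_c}(⌊(n−3)/2⌋))) → ∞`.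

Cell `prim-rsw3` (LANE 3), lead seat, gen 18.  Support file (`--supports stmt-CriticalPhenomena-4575`); no definitions, no named facts,
no sorries.  Files (1)–(4) of the gen treat the finite-size THRESHOLDS `p_n(λ)`; this file evaluates the Talagrand–Russo inequality AT `p = p_c`
itself, where the band condition `e^{−Λ/4} ≤ Π_{p_c}(n)(1−Π_{p_c}(n))` is exactly the lane's open two-sided cube RSW (`CubeCrossingNondegenerate`).

* **`eventually_cube_criticalProbI_dichotomy`** — for all large `n`: `Π_{p_c}(n)(1−Π_{p_c}(n)) < (2π_{p_c}(⌊(n−3)/2⌋))^{1/4}` OR the slope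
  of the cube crossing curve at `p_c` (= E_{p_c}[N_piv], Russo) is `≥ (Λ_n/16)·Π_{p_c}(n)(1−Π_{p_c}(n))` — unconditional.
* **`eventually_log_le_cube_deriv_criticalProbI_of_cubeCrossingNondegenerate`** — `CubeCrossingNondegenerate → ∃ c > 0 ∀ᶠ n:
  E_{p_c}[N_piv(n)] ≥ c·log(1/(2π_{p_c}(⌊(n−3)/2⌋)))` (→ ∞): THE BCKS POSTULATE FOR THE CUBE FORCES DIVERGING PIVOTAL COUNTS AT CRITICALITY
  (planar analogue: `n²α₄(n) = n^{3/4}` at `p = 1/2`); a bounded expected pivotal count along a subsequence would refute it.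

References: M. Talagrand, Ann. Probab. 22 (1994) Cor. 1.2; G. Grimmett, *Probability on Graphs* (2010) §4.7 Thm. 4.81; C. Borgs, J. Chayes,
H. Kesten, J. Spencer, Random Structures Algorithms 15 (1999) §1 (hyperscaling postulates).
-/

noncomputable section

namespace Summit.CriticalPhenomena.PercolationContinuityZ3.Theorems.Crossing

open MeasureTheory Filter Topology Literature.Probability.LatticeModels Literature.Probability.Percolation SimpleGraph

/-! ## At criticality: the dichotomy, and BCKS non-degeneracy forces diverging pivotal counts at `p_c` -/

/-- **THE DICHOTOMY AT `p_c(ℤ³)`** (unconditional; p205010 only to make `Λ_n → ∞`): for all large `n`, with `π = π_{p_c}(⌊(n−3)/2⌋)` and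
`Π = Π_{p_c}(n)`: EITHER the cube crossing at `p_c` is nearly decided, `Π(1−Π) < (2π)^{1/4}`, OR its slope at `p_c` — the expected number of
pivotal edges AT CRITICALITY — is `≥ (1/16)·log(1/(2π))·Π(1−Π)`.  (Which alternative holds is the open two-sided cube RSW; numerically
`Π ≈ 0.3–0.5` at `p*`, i.e. the second.) [cite: Talagrand1994, Cor. 1.2] [cite: Grimmett2010, §4.7 Thm. 4.81]
[cite: BorgsChayesKestenSpencer1999, §1 (postulates: crossing probabilities of fixed shapes bounded away from 0 and 1)] -/
theorem eventually_cube_criticalProbI_dichotomy :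
    ∀ᶠ n : ℕ in atTop,
      boxCrossProb 3 (criticalProbI 3) (cubeShape n) 0 * (1 - boxCrossProb 3 (criticalProbI 3) (cubeShape n) 0) <
          (2 * oneArmProb 3 (criticalProbI 3) ((n - 3) / 2)) ^ ((1 : ℝ) / 4) ∨
        ∃ D : ℝ, HasDerivAt (fun q : ℝ => boxCrossProb 3 (Set.projIcc (0 : ℝ) 1 zero_le_one q) (cubeShape n) 0) D (criticalProbI 3) ∧
          Real.log (1 / (2 * oneArmProb 3 (criticalProbI 3) ((n - 3) / 2))) / 16 *
              (boxCrossProb 3 (criticalProbI 3) (cubeShape n) 0 * (1 - boxCrossProb 3 (criticalProbI 3) (cubeShape n) 0)) ≤ D := by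
  obtain ⟨hpc0, hpc1⟩ := criticalProbI_three_pos_lt_one
  have hπ := tendsto_oneArmProb_half_of_tendsto_criticalProbI (w := fun _ => criticalProbI 3) tendsto_const_nhds
  have hsmallev : ∀ᶠ n : ℕ in atTop, 2 * oneArmProb 3 (criticalProbI 3) ((n - 3) / 2) < Real.exp (-64) := by
    have h2 : Tendsto (fun n : ℕ => 2 * oneArmProb 3 (criticalProbI 3) ((n - 3) / 2)) atTop (𝓝 0) := by
      simpa using hπ.const_mul 2
    exact h2.eventually (eventually_lt_nhds (Real.exp_pos _))
  filter_upwards [hsmallev, eventually_ge_atTop 3] with n hn hn3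
  set π2 : ℝ := 2 * oneArmProb 3 (criticalProbI 3) ((n - 3) / 2) with hπ2
  set P : ℝ := boxCrossProb 3 (criticalProbI 3) (cubeShape n) 0 with hP
  have hm : 2 * (((n - 3) / 2 : ℕ) : ℤ) + 3 ≤ cubeShape n 0 := two_mul_half_add_three_le_cubeShape hn3
  have hπ2nn : 0 ≤ π2 := mul_nonneg (by norm_num) measureReal_nonneg
  rcases hπ2nn.lt_or_eq with hπ0 | hπ0
  · set Λ : ℝ := Real.log (1 / π2) with hΛdef
    have hΛeq : Real.exp (-Λ) = π2 := by rw [hΛdef, one_div, Real.log_inv, neg_neg, Real.exp_log hπ0]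
    have hΛ64 : 64 ≤ Λ := by
      have : Real.exp (-Λ) < Real.exp (-64) := by rw [hΛeq]; exact hn
      have := Real.exp_lt_exp.1 this
      linarith
    have hroot : Real.exp (-(Λ / 4)) = π2 ^ ((1 : ℝ) / 4) := by
      rw [Real.rpow_def_of_pos hπ0, hΛdef, one_div, Real.log_inv]
      congr 1; ring
    by_cases hcond : Real.exp (-(Λ / 4)) ≤ P * (1 - P)
    · right
      have hsmall : 2 * oneArmProb 3 (criticalProbI 3) ((n - 3) / 2) ≤ Real.exp (-Λ) := by rw [hΛeq]
      obtain ⟨D, hD, hDge⟩ :=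
        exists_hasDerivAt_boxCrossProb_ge (cubeShape n) 0 hm (criticalProbI 3) hpc0 hpc1 hΛ64 hsmall hcond
      refine ⟨D, hD, ?_⟩
      have : Λ / 16 * (P * (1 - P)) = Real.log (1 / π2) / 16 * (P * (1 - P)) := by rw [hΛdef]
      linarith
    · left
      push Not at hcond
      rw [← hroot]; exact hcond
  · -- `π2 = 0`: the first alternative reads `P(1−P) < 0^{1/4} = 0`, false in general; use the second with Russo's `D ≥ 0`
    right
    classical
    refine ⟨_, hasDerivAt_boxCrossProb (cubeShape n) 0 (criticalProbI 3) hpc0 hpc1, ?_⟩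
    have hlog : Real.log (1 / π2) = 0 := by rw [← hπ0]; simp
    rw [hlog, zero_div, zero_mul]
    exact Finset.sum_nonneg fun e _ => measureReal_nonneg

/-- **BCKS NON-DEGENERACY OF THE CUBE CROSSING FORCES DIVERGING PIVOTAL COUNTS AT `p_c`**: if `CubeCrossingNondegenerate` (the lane's typed
hyperscaling postulate: `c ≤ Π_{p_c}(n) ≤ 1 − c` for all `n ≥ 1`; OPEN), then there is `c′ > 0` such that for all large `n` the slope of the
cube crossing curve AT `p_c` — the expected number of pivotal edges at criticality — is `≥ c′·log(1/(2π_{p_c}(⌊(n−3)/2⌋)))`, which tends to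
`+∞` (`θ(p_c) = 0`).  The planar analogue is the `n^{3/4}` pivotal count at `p = 1/2`; a bounded expected pivotal count at `p_c(ℤ³)` along a
subsequence would REFUTE `CubeCrossingNondegenerate`. [cite: BorgsChayesKestenSpencer1999, §1 (postulates: crossing probabilities of fixed shapes bounded away from 0 and 1)]
[cite: Talagrand1994, Cor. 1.2] [cite: Grimmett2010, §4.7 Thm. 4.81] -/
theorem eventually_log_le_cube_deriv_criticalProbI_of_cubeCrossingNondegenerate (h : CubeCrossingNondegenerate) :
    ∃ c : ℝ, 0 < c ∧ ∀ᶠ n : ℕ in atTop, ∃ D : ℝ,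
      HasDerivAt (fun q : ℝ => boxCrossProb 3 (Set.projIcc (0 : ℝ) 1 zero_le_one q) (cubeShape n) 0) D (criticalProbI 3) ∧
        c * Real.log (1 / (2 * oneArmProb 3 (criticalProbI 3) ((n - 3) / 2))) ≤ D := by
  obtain ⟨⟨c₁, hc₁, h₁⟩, ⟨c₂, hc₂, h₂⟩⟩ := h
  obtain ⟨hpc0, hpc1⟩ := criticalProbI_three_pos_lt_one
  set lam : ℝ := min c₁ c₂ with hlamdef
  have hlam0 : 0 < lam := lt_min hc₁ hc₂
  -- `Π ∈ [lam, 1 - lam]` at every `n ≥ 1`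
  have hband : ∀ n : ℕ, 1 ≤ n → lam ≤ boxCrossProb 3 (criticalProbI 3) (cubeShape n) 0 ∧
      boxCrossProb 3 (criticalProbI 3) (cubeShape n) 0 ≤ 1 - lam := by
    intro n hn
    have ha := h₁ n hn
    have hb := h₂ n hn
    have hcompl : (bondPercolation (zdGraph 3) (criticalProbI 3)).real (boxCross (cubeShape n) 0)ᶜ =
        1 - (bondPercolation (zdGraph 3) (criticalProbI 3)).real (boxCross (cubeShape n) 0) := by
      rw [measureReal_compl (measurableSet_boxCross _ 0), probReal_univ]
    rw [hcompl] at hb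
    refine ⟨?_, ?_⟩
    · exact (min_le_left _ _).trans ha
    · have : lam ≤ c₂ := min_le_right _ _
      rw [boxCrossProb]; linarith
  have hv : 0 < lam * (1 - lam) := by
    have h1 := hband 1 le_rfl
    have : lam ≤ 1 - lam := h1.1.trans h1.2
    exact mul_pos hlam0 (by linarith)
  have hπ := tendsto_oneArmProb_half_of_tendsto_criticalProbI (w := fun _ => criticalProbI 3) tendsto_const_nhds
  have hsmallev : ∀ᶠ n : ℕ in atTop, 2 * oneArmProb 3 (criticalProbI 3) ((n - 3) / 2) < (lam * (1 - lam)) ^ 4 := by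
    have h2 : Tendsto (fun n : ℕ => 2 * oneArmProb 3 (criticalProbI 3) ((n - 3) / 2)) atTop (𝓝 0) := by
      simpa using hπ.const_mul 2
    exact h2.eventually (eventually_lt_nhds (pow_pos hv 4))
  refine ⟨lam * (1 - lam) / 16, by positivity, ?_⟩
  filter_upwards [eventually_cube_criticalProbI_dichotomy, hsmallev, eventually_ge_atTop 1] with n hn hsmall hn1
  set π2 : ℝ := 2 * oneArmProb 3 (criticalProbI 3) ((n - 3) / 2) with hπ2
  set P : ℝ := boxCrossProb 3 (criticalProbI 3) (cubeShape n) 0 with hP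
  obtain ⟨hPl, hPu⟩ := hband n hn1
  have hPP : lam * (1 - lam) ≤ P * (1 - P) := mul_one_sub_le_mul_one_sub hPl hPu
  have hπ2nn : 0 ≤ π2 := mul_nonneg (by norm_num) measureReal_nonneg
  rcases hn with hdec | ⟨D, hD, hDge⟩
  · -- the 'nearly decided' alternative contradicts the band: `(2π)^{1/4} < λ(1−λ) ≤ P(1−P)`
    exfalso
    have hroot : π2 ^ ((1 : ℝ) / 4) < lam * (1 - lam) := by
      have h4 : (lam * (1 - lam)) = ((lam * (1 - lam)) ^ (4 : ℝ)) ^ ((1 : ℝ) / 4) := by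
        rw [← Real.rpow_mul hv.le]; norm_num
      rw [h4]
      apply Real.rpow_lt_rpow hπ2nn _ (by norm_num)
      have : (lam * (1 - lam)) ^ (4 : ℝ) = (lam * (1 - lam)) ^ (4 : ℕ) := by norm_cast
      rw [this]; exact hsmall
    linarith
  · refine ⟨D, hD, ?_⟩
    have hlog : 0 ≤ Real.log (1 / π2) := by
      rcases hπ2nn.lt_or_eq with h0 | h0
      · refine Real.log_nonneg ?_
        rw [le_div_iff₀ h0]
        have : π2 ≤ 1 := by
          have := hsmall; have : (lam * (1 - lam)) ^ 4 ≤ 1 := by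
            apply pow_le_one₀ hv.le; nlinarith [hPl, hPu]
          linarith
        linarith
      · rw [← h0]; simp
    calc lam * (1 - lam) / 16 * Real.log (1 / π2) ≤ Real.log (1 / π2) / 16 * (P * (1 - P)) := by
          rw [div_mul_eq_mul_div, div_mul_eq_mul_div]
          apply div_le_div_of_nonneg_right _ (by norm_num)
          nlinarith
      _ ≤ D := hDge

end Summit.CriticalPhenomena.PercolationContinuityZ3.Theorems.Crossing

end
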